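import Mathlib.Analysis.InnerProductSpace.Calculus
import Literature.Topology.FourManifolds.NeckConnectedSum
import Literature.Topology.FourManifolds.NeckSeparation
import Literature.Topology.FourManifolds.ConnectedSumSummands
import Literature.Topology.FourManifolds.GluingConstruction
import Literature.Topology.FourManifolds.CorkDecompositionSplittingProof
import HarnessLib

/-!
# Capping the sides of a neck: surgery along a neck yields a connected-sum splitting

Topological content of the surgery step of the Ricci flow with surgery (R. Hamilton,
*Four-manifolds with positive isotropic curvature*, Comm. Anal. Geom. 5 (1997), §1.1, pp. 3–4:
"we replace `S³ × B¹` with two copies of the ball `B⁴` by cutting the neck and rounding off the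
ends … we can then recover the original manifold by … doing surgeries replacing two `B⁴`'s with an
`S³ × B¹`"; B.-L. Chen, X.-P. Zhu, J. Differential Geom. 74 (2006), §5, arXiv p. 25: "in every
`ε`-horn … cut it along the middle three-sphere, remove the horn-shaped end, and glue back a cap
… `Ω̄ⱼ` denotes `Ωⱼ` with each `ε`-horn one point compactified … `M⁴` is diffeomorphic to a
connected sum of the `Ω̄ⱼ` …"), for the tree's relational connected sum `Literature.Topology.FourManifolds.IsConnectedSum`:

* `Literature.polar θ₀ : OpenPartialHomeomorph (Sⁿ × ℝ) E` — polar coordinates `(θ, t) ↦ t • θ` of a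
  real inner product space `E` of dimension `n + 1`, a diffeomorphism `Sⁿ × (0, ∞) ≅ E ∖ {0}`
  (`contMDiff_polarVec`, `contMDiffOn_polarInv`).
* `Literature.NeckCapData n ψ` — a **side** of a neck `ψ : Sⁿ × ℝ ↪ P` (a smooth embedding with open
  range into a manifold `P` modelled on `E`): an open set `A ⊆ P` containing the upper
  half-neck `ψ (Sⁿ × (0, ∞))`, missing the lower closed half-neck, and such that `A ∪ ψ (Sⁿ × {0})`
  is closed (i.e. the far side is open).
* `D.Capped` (for `D : NeckCapData n ψ`) — **the capped side** `A ∪ {∞}`: the pushout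
  (`Literature.Topology.FourManifolds.SmoothGlueData.Glued`, `GluingConstruction.lean`) of `A` and the disc `E` along the polar
  identification `ψ (θ, t) ∼ t • θ` (`t > 0`) of the upper half-neck with the punctured disc —
  Chen–Zhu's "one point compactification" of the end of `A`, Hamilton's "rounding off"; a smooth
  manifold modelled on `E`, Hausdorff (`instT2SpaceCapped`: the graph of the identification is
  closed, the only delicate point being the centre of the disc, handled by the tube lemma around
  the compact middle sphere) and compact when `P` is (`instCompactSpaceCapped`); the structure
  maps are `D.glueData.inl : A → D.Capped` (open smooth embedding with range the complement
  of the centre, `range_inl`) and the disc `D.glueData.inr : E → D.Capped` (`inl_eq_inr`).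
* `Literature.Topology.FourManifolds.NeckCapData.isConnectedSum_capped` (**main result**): if `D₁`, `D₂` are the two sides of
  a neck (for `ψ` and for the flipped neck `ψ⁻ (θ, t) = ψ (θ, -t)`), disjoint and covering the
  complement of the middle sphere, then `P` is the connected sum of the two capped sides:
  `IsConnectedSum 𝓘(ℝ, E) 𝓘(ℝ, E) 𝓘(ℝ, E) D₁.Capped D₂.Capped P`
  (by `Literature.Topology.FourManifolds.isConnectedSum_of_neck'`, `NeckConnectedSum.lean`).
* `D.isSmoothEmbedding_inl_comp`: a smooth embedding (e.g. another neck) into the side is one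
  into the capped side — via the corestriction lemma `Manifold.IsSmoothEmbedding.codRestrict_opens`
  (from the tree's pointwise `Manifold.IsImmersionAtOfComplement.codRestrict_opens`,
  `CorkDecompositionSplittingProof.lean`) — so that surgeries along disjoint necks can be done one
  at a time.
* `Literature.Topology.FourManifolds.exists_isConnectedSum_capped_of_simplyConnected`: in a compact, connected, **simply
  connected** `P` every neck (`n ≠ 0`) has two such sides (`Literature.Topology.FourManifolds.exists_two_sides_of_neck`,
  `NeckSeparation.lean`, Hirsch's Thm. 4.6), so surgery along any neck writes `P` as a connected
  sum `M₁ # M₂` of two compact simply connected manifolds (`ConnectedSumSummands.lean`,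
  Kosinski VI Prop. 2.1) — the form in which Hamilton's reconstruction is used for Cor. 1.2(a)
  (`Literature.Geometry.Riemannian.hamilton_pic_sphere_four`).

## References

* R. S. Hamilton, *Four-manifolds with positive isotropic curvature*, Comm. Anal. Geom. 5 (1997)
  1–92, §1.1 pp. 3–4, §4 (Section D: surgery). [Hamilton1997]
* B.-L. Chen, X.-P. Zhu, *Ricci flow with surgery on four-manifolds with positive isotropic
  curvature*, J. Differential Geom. 74 (2006) 177–264, §5 (arXiv:math/0504478, pp. 24–25).
  [ChenZhu2006]
* A. Kosinski, *Differential Manifolds*, Academic Press (1993), Ch. VI §1 (p. 90), §9 (p. 112).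
  [Kosinski1993]
* M. W. Hirsch, *Differential Topology*, GTM 33 (1976), Ch. 4, Thm. 4.6. [Hirsch1976]
-/

open scoped Manifold ContDiff Topology
open Set Function Metric Filter Topology Module OpenPartialHomeomorph

noncomputable section

namespace Literature.Topology.FourManifolds

universe u v

/-! ### Polar coordinates -/

section Polar

variable {E : Type*} [NormedAddCommGroup E] [InnerProductSpace ℝ E]

/-- The direction `x / ‖x‖ ∈ Sⁿ` of a vector (`θ₀` for `x = 0`). [folklore] -/
def unitDir (θ₀ : sphere (0 : E) 1) (x : E) : sphere (0 : E) 1 := by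
  classical
  exact if h : x = 0 then θ₀ else ⟨‖x‖⁻¹ • x, by
    rw [mem_sphere_zero_iff_norm, norm_smul, norm_inv, norm_norm,
      inv_mul_cancel₀ (norm_ne_zero_iff.2 h)]⟩

/-- The direction of a nonzero vector is `x / ‖x‖`. [folklore] -/
theorem coe_unitDir_of_ne (θ₀ : sphere (0 : E) 1) {x : E} (hx : x ≠ 0) :
    (unitDir θ₀ x : E) = ‖x‖⁻¹ • x := by
  classical
  unfold unitDir
  rw [dif_neg hx]

/-- The direction of `t • θ` (`t > 0`, `θ ∈ Sⁿ`) is `θ`. [folklore] -/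
theorem unitDir_smul (θ₀ θ : sphere (0 : E) 1) {t : ℝ} (ht : 0 < t) :
    unitDir θ₀ (t • (θ : E)) = θ := by
  have hθ : ‖(θ : E)‖ = 1 := mem_sphere_zero_iff_norm.1 θ.2
  have hne : t • (θ : E) ≠ 0 := smul_ne_zero ht.ne' (ne_zero_of_mem_unit_sphere θ)
  apply Subtype.ext
  rw [coe_unitDir_of_ne θ₀ hne, norm_smul, hθ, mul_one, Real.norm_eq_abs, abs_of_pos ht, smul_smul,
    inv_mul_cancel₀ ht.ne', one_smul]

/-- `‖x‖ • (x / ‖x‖) = x`. [folklore] -/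
theorem norm_smul_coe_unitDir (θ₀ : sphere (0 : E) 1) {x : E} (hx : x ≠ 0) :
    ‖x‖ • (unitDir θ₀ x : E) = x := by
  rw [coe_unitDir_of_ne θ₀ hx, smul_smul, mul_inv_cancel₀ (norm_ne_zero_iff.2 hx), one_smul]

/-- Polar coordinates `(θ, t) ↦ t • θ`. [folklore] -/
def polarVec (q : sphere (0 : E) 1 × ℝ) : E := q.2 • (q.1 : E)

/-- Inverse polar coordinates `x ↦ (x / ‖x‖, ‖x‖)` (junk direction at `0`). [folklore] -/
def polarInv (θ₀ : sphere (0 : E) 1) (x : E) : sphere (0 : E) 1 × ℝ := (unitDir θ₀ x, ‖x‖)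

/-- `‖t • θ‖ = |t|`. [folklore] -/
theorem norm_polarVec (q : sphere (0 : E) 1 × ℝ) : ‖polarVec q‖ = |q.2| := by
  rw [polarVec, norm_smul, mem_sphere_zero_iff_norm.1 q.1.2, mul_one, Real.norm_eq_abs]

/-- `t • θ ≠ 0` for `t > 0`. [folklore] -/
theorem polarVec_ne_zero {q : sphere (0 : E) 1 × ℝ} (hq : 0 < q.2) : polarVec q ≠ 0 := by
  rw [← norm_pos_iff, norm_polarVec]
  exact abs_pos.2 hq.ne'

/-- `polarInv (t • θ) = (θ, t)` for `t > 0`. [folklore] -/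
theorem polarInv_polarVec (θ₀ : sphere (0 : E) 1) {q : sphere (0 : E) 1 × ℝ} (hq : 0 < q.2) :
    polarInv θ₀ (polarVec q) = q := by
  obtain ⟨θ, t⟩ := q
  change 0 < t at hq
  refine Prod.ext ?_ ?_
  · exact unitDir_smul θ₀ θ hq
  · change ‖polarVec (θ, t)‖ = t
    rw [norm_polarVec, abs_of_pos hq]

/-- `polarVec (polarInv x) = x` for `x ≠ 0`. [folklore] -/
theorem polarVec_polarInv (θ₀ : sphere (0 : E) 1) {x : E} (hx : x ≠ 0) :
    polarVec (polarInv θ₀ x) = x :=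
  norm_smul_coe_unitDir θ₀ hx

/-- Polar coordinates are continuous. [folklore] -/
theorem continuous_polarVec : Continuous (polarVec : sphere (0 : E) 1 × ℝ → E) :=
  continuous_snd.smul (continuous_subtype_val.comp continuous_fst)

/-- The direction map is continuous off the origin. [folklore] -/
theorem continuousOn_unitDir (θ₀ : sphere (0 : E) 1) : ContinuousOn (unitDir θ₀) {0}ᶜ := by
  rw [IsInducing.subtypeVal.continuousOn_iff]
  have h : ContinuousOn (fun x : E => ‖x‖⁻¹ • x) {0}ᶜ :=
    (continuous_norm.continuousOn.inv₀ fun x hx => norm_ne_zero_iff.2 hx).smul continuousOn_id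
  exact h.congr fun x hx => coe_unitDir_of_ne θ₀ hx

/-- Inverse polar coordinates are continuous off the origin. [folklore] -/
theorem continuousOn_polarInv (θ₀ : sphere (0 : E) 1) : ContinuousOn (polarInv θ₀) {0}ᶜ :=
  (continuousOn_unitDir θ₀).prodMk continuous_norm.continuousOn

/-- **Polar coordinates** as an open partial homeomorphism `Sⁿ × (0, ∞) ≅ E ∖ {0}`. [folklore] -/
def polar (θ₀ : sphere (0 : E) 1) : OpenPartialHomeomorph (sphere (0 : E) 1 × ℝ) E where
  toFun := polarVec
  invFun := polarInv θ₀
  source := univ ×ˢ Ioi 0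
  target := {0}ᶜ
  map_source' := fun _ hq => polarVec_ne_zero hq.2
  map_target' := fun _ hx => ⟨mem_univ _, norm_pos_iff.2 hx⟩
  left_inv' := fun _ hq => polarInv_polarVec θ₀ hq.2
  right_inv' := fun _ hx => polarVec_polarInv θ₀ hx
  open_source := isOpen_univ.prod isOpen_Ioi
  open_target := isOpen_compl_singleton
  continuousOn_toFun := continuous_polarVec.continuousOn
  continuousOn_invFun := continuousOn_polarInv θ₀

/-- `polar` acts as `polarVec`. [folklore] -/
@[simp] theorem polar_apply (θ₀ : sphere (0 : E) 1) (q : sphere (0 : E) 1 × ℝ) :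
    polar θ₀ q = polarVec q := rfl

/-- `polar.symm` acts as `polarInv`. [folklore] -/
@[simp] theorem polar_symm_apply (θ₀ : sphere (0 : E) 1) (x : E) :
    (polar θ₀).symm x = polarInv θ₀ x := rfl

/-- The source of `polar` is `Sⁿ × (0, ∞)`. [folklore] -/
@[simp] theorem polar_source (θ₀ : sphere (0 : E) 1) :
    (polar θ₀).source = univ ×ˢ Ioi 0 := rfl

/-- The target of `polar` is `E ∖ {0}`. [folklore] -/
@[simp] theorem polar_target (θ₀ : sphere (0 : E) 1) : (polar θ₀).target = {0}ᶜ := rfl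

variable {n : ℕ} [Fact (finrank ℝ E = n + 1)]

/-- A chosen point of the unit sphere (nonempty as `dim E = n + 1 ≥ 1`). [folklore] -/
def unitSpherePoint (n : ℕ) [Fact (finrank ℝ E = n + 1)] : sphere (0 : E) 1 :=
  haveI : Nontrivial E := Module.nontrivial_of_finrank_eq_succ (Fact.out : finrank ℝ E = n + 1)
  ⟨(NormedSpace.sphere_nonempty.2 zero_le_one : (sphere (0 : E) 1).Nonempty).some,
    (NormedSpace.sphere_nonempty.2 zero_le_one : (sphere (0 : E) 1).Nonempty).some_mem⟩

/-- Polar coordinates are smooth. [folklore] -/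
theorem contMDiff_polarVec :
    ContMDiff ((𝓡 n).prod 𝓘(ℝ, ℝ)) 𝓘(ℝ, E) ∞ (polarVec : sphere (0 : E) 1 × ℝ → E) :=
  contMDiff_snd.smul (contMDiff_coe_sphere.comp contMDiff_fst)

/-- The direction map is smooth off the origin. [folklore] -/
theorem contMDiffOn_unitDir (θ₀ : sphere (0 : E) 1) :
    ContMDiffOn 𝓘(ℝ, E) (𝓡 n) ∞ (unitDir θ₀) {0}ᶜ := by
  intro x hx
  let U : TopologicalSpace.Opens E := ⟨{0}ᶜ, isOpen_compl_singleton⟩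
  have h1 : ContMDiffOn 𝓘(ℝ, E) 𝓘(ℝ, E) ∞ (fun y : E => ‖y‖⁻¹ • y) {0}ᶜ := by
    rw [contMDiffOn_iff_contDiffOn]
    exact fun y hy =>
      (((contDiffAt_norm ℝ hy).inv (norm_ne_zero_iff.2 hy)).smul contDiffAt_id).contDiffWithinAt
  have hg : ContMDiff 𝓘(ℝ, E) 𝓘(ℝ, E) ∞ (fun y : U => ‖(y : E)‖⁻¹ • (y : E)) :=
    h1.comp_contMDiff contMDiff_subtype_val fun y => y.2
  have hg' : ∀ y : U, ‖(y : E)‖⁻¹ • (y : E) ∈ sphere (0 : E) 1 := fun y => by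
    rw [mem_sphere_zero_iff_norm, norm_smul, norm_inv, norm_norm,
      inv_mul_cancel₀ (norm_ne_zero_iff.2 y.2)]
  have hcod := hg.codRestrict_sphere (n := n) hg'
  have heq : (fun y : U => unitDir θ₀ (y : E)) = Set.codRestrict _ _ hg' := by
    funext y
    apply Subtype.ext
    rw [coe_unitDir_of_ne θ₀ y.2]
    rfl
  have h2 : ContMDiffAt 𝓘(ℝ, E) (𝓡 n) ∞ (fun y : U => unitDir θ₀ (y : E)) ⟨x, hx⟩ := by
    rw [heq]
    exact hcod _
  exact (contMDiffAt_subtype_iff.1 h2).contMDiffWithinAt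

/-- Inverse polar coordinates are smooth off the origin. [folklore] -/
theorem contMDiffOn_polarInv (θ₀ : sphere (0 : E) 1) :
    ContMDiffOn 𝓘(ℝ, E) ((𝓡 n).prod 𝓘(ℝ, ℝ)) ∞ (polarInv θ₀) {0}ᶜ := by
  have h : ContMDiffOn 𝓘(ℝ, E) 𝓘(ℝ, ℝ) ∞ (fun x : E => ‖x‖) {0}ᶜ := by
    rw [contMDiffOn_iff_contDiffOn]
    exact fun x hx => (contDiffAt_norm ℝ hx).contDiffWithinAt
  exact (contMDiffOn_unitDir θ₀).prodMk h

end Polar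

/-! ### Corestriction of immersions and smooth embeddings to open submanifolds

A Mathlib gap needed to iterate surgeries (a neck lying in a side of a previous neck is a neck of
the capped side, `NeckCapData.isSmoothEmbedding_inl_comp` below): the corestriction of an
immersion / smooth embedding to an open submanifold containing its image is again one. -/

section Corestrict

variable {EM HM : Type*} [NormedAddCommGroup EM] [NormedSpace ℝ EM] [TopologicalSpace HM]
  {IM : ModelWithCorners ℝ EM HM} {X : Type*} [TopologicalSpace X] [ChartedSpace HM X]
  {EN : Type u} {HN : Type*} [NormedAddCommGroup EN] [NormedSpace ℝ EN] [TopologicalSpace HN]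
  {IN : ModelWithCorners ℝ EN HN} {Y : Type*} [TopologicalSpace Y] [ChartedSpace HN Y]

/-- **Corestriction of a `C^∞` immersion to an open submanifold** containing its image is an
immersion (pointwise, with a chosen complement, this is the tree's
`Manifold.IsImmersionAtOfComplement.codRestrict_opens`, `CorkDecompositionSplittingProof.lean`).
[folklore] -/
theorem _root_.Manifold.IsImmersion.codRestrict_opens [IsManifold IM ∞ X] [IsManifold IN ∞ Y]
    {f : X → Y} (hf : Manifold.IsImmersion IM IN ∞ f) (U : TopologicalSpace.Opens Y)
    (hU : ∀ y, f y ∈ U) : Manifold.IsImmersion IM IN ∞ (fun y => (⟨f y, hU y⟩ : U)) := by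
  obtain ⟨F', _, _, h⟩ := hf
  exact Manifold.IsImmersionOfComplement.isImmersion fun x => (h x).codRestrict_opens U hU

/-- **Corestriction of a smooth embedding to an open submanifold** containing its image is a
smooth embedding (Lee, *Introduction to Smooth Manifolds*, Ch. 5: the image of an embedding into
an open submanifold). [folklore] -/
theorem _root_.Manifold.IsSmoothEmbedding.codRestrict_opens [IsManifold IM ∞ X] [IsManifold IN ∞ Y]
    {f : X → Y} (hf : Manifold.IsSmoothEmbedding IM IN ∞ f) (U : TopologicalSpace.Opens Y)
    (hU : ∀ y, f y ∈ U) : Manifold.IsSmoothEmbedding IM IN ∞ (fun y => (⟨f y, hU y⟩ : U)) :=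
  ⟨hf.isImmersion.codRestrict_opens U hU, hf.isEmbedding.codRestrict (U : Set Y) hU⟩

end Corestrict

/-! ### Sides of a neck and their caps -/

section Cap

variable {E : Type v} [NormedAddCommGroup E] [InnerProductSpace ℝ E] {n : ℕ}
  [Fact (finrank ℝ E = n + 1)]
  {P : Type u} [TopologicalSpace P] [ChartedSpace E P]

/-- **A side of a neck.** For a neck `ψ : Sⁿ × ℝ → P` — a smooth embedding with open range into
a manifold `P` modelled on the inner product space `E ⊇ Sⁿ` of dimension `n + 1` — a *side* is an
open set `A ⊆ P` which contains the upper half-neck `ψ (Sⁿ × (0, ∞))`, misses the closed lower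
half-neck `ψ (Sⁿ × (-∞, 0])`, and is closed up to the middle sphere: `A ∪ ψ (Sⁿ × {0})` is
closed (equivalently, the rest `P ∖ (A ∪ ψ (Sⁿ × {0}))` is open). When the middle sphere
separates `P` (always, if `P` is simply connected: `Literature.Topology.FourManifolds.exists_two_sides_of_neck`), the two
halves of the complement are sides of `ψ` and of the flipped neck `(θ, t) ↦ ψ (θ, -t)`
(Hamilton 1997, §1.1; Hirsch, *Differential Topology*, Ch. 4, Lemma 4.4). [folklore] -/
structure NeckCapData (n : ℕ) [Fact (finrank ℝ E = n + 1)] (ψ : sphere (0 : E) 1 × ℝ → P) where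
  /-- The neck is a smooth embedding. -/
  isSmoothEmbedding : Manifold.IsSmoothEmbedding ((𝓡 n).prod 𝓘(ℝ, ℝ)) 𝓘(ℝ, E) ∞ ψ
  /-- The neck has open range. -/
  isOpen_range : IsOpen (range ψ)
  /-- The side: an open subset of `P`. -/
  side : TopologicalSpace.Opens P
  /-- The side together with the middle sphere is closed. -/
  isClosed_side_union : IsClosed ((side : Set P) ∪ ψ '' (univ ×ˢ {0}))
  /-- The side contains the upper half-neck. -/
  image_Ioi_subset : ψ '' (univ ×ˢ Ioi 0) ⊆ side
  /-- The side misses the closed lower half-neck. -/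
  not_mem_side : ∀ (θ : sphere (0 : E) 1) (t : ℝ), t ≤ 0 → ψ (θ, t) ∉ side

namespace NeckCapData

variable {ψ : sphere (0 : E) 1 × ℝ → P}

/-- The neck is injective. [folklore] -/
theorem injective (D : NeckCapData n ψ) : Injective ψ := D.isSmoothEmbedding.isEmbedding.injective

/-- The neck is an open embedding. [folklore] -/
theorem isOpenEmbedding (D : NeckCapData n ψ) : IsOpenEmbedding ψ :=
  ⟨D.isSmoothEmbedding.isEmbedding, D.isOpen_range⟩

/-- Points `ψ (θ, t)`, `t > 0`, of the upper half-neck lie in the side. [folklore] -/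
theorem mem_side (D : NeckCapData n ψ) (θ : sphere (0 : E) 1) {t : ℝ} (ht : 0 < t) : ψ (θ, t) ∈ D.side :=
  D.image_Ioi_subset ⟨(θ, t), ⟨mem_univ _, ht⟩, rfl⟩

/-- A point `ψ (θ, t)` of the neck lies in the side iff `t > 0`. [folklore] -/
theorem mem_side_iff (D : NeckCapData n ψ) (θ : sphere (0 : E) 1) (t : ℝ) : ψ (θ, t) ∈ D.side ↔ 0 < t :=
  ⟨fun h => not_le.1 fun ht => D.not_mem_side θ t ht h, D.mem_side θ⟩

/-- The side is nonempty. [folklore] -/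
theorem nonempty_side (D : NeckCapData n ψ) : Nonempty D.side :=
  ⟨⟨ψ (unitSpherePoint n, 1), D.mem_side _ one_pos⟩⟩

/-- The neck as an open partial homeomorphism `Sⁿ × ℝ ≅ range ψ`. [folklore] -/
def Ψ (D : NeckCapData n ψ) : OpenPartialHomeomorph (sphere (0 : E) 1 × ℝ) P :=
  haveI : Nonempty (sphere (0 : E) 1 × ℝ) := ⟨(unitSpherePoint n, 0)⟩
  D.isOpenEmbedding.toOpenPartialHomeomorph ψ

/-- `Ψ` acts as `ψ`. [folklore] -/
@[simp] theorem Ψ_apply (D : NeckCapData n ψ) (q : sphere (0 : E) 1 × ℝ) : D.Ψ q = ψ q := rfl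

/-- The source of `Ψ` is everything. [folklore] -/
@[simp] theorem Ψ_source (D : NeckCapData n ψ) : D.Ψ.source = univ := by
  haveI : Nonempty (sphere (0 : E) 1 × ℝ) := ⟨(unitSpherePoint n, 0)⟩
  exact D.isOpenEmbedding.toOpenPartialHomeomorph_source ψ

/-- The target of `Ψ` is the range of the neck. [folklore] -/
@[simp] theorem Ψ_target (D : NeckCapData n ψ) : D.Ψ.target = range ψ := by
  haveI : Nonempty (sphere (0 : E) 1 × ℝ) := ⟨(unitSpherePoint n, 0)⟩
  exact D.isOpenEmbedding.toOpenPartialHomeomorph_target ψ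

/-- `Ψ.symm` inverts `ψ`. [folklore] -/
@[simp] theorem Ψ_symm_apply (D : NeckCapData n ψ) (q : sphere (0 : E) 1 × ℝ) :
    D.Ψ.symm (ψ q) = q := by
  haveI : Nonempty (sphere (0 : E) 1 × ℝ) := ⟨(unitSpherePoint n, 0)⟩
  exact D.isOpenEmbedding.toOpenPartialHomeomorph_left_inv

/-- `ψ` inverts `Ψ.symm` on the range. [folklore] -/
theorem apply_Ψ_symm (D : NeckCapData n ψ) {p : P} (hp : p ∈ range ψ) :
    ψ (D.Ψ.symm p) = p := by
  haveI : Nonempty (sphere (0 : E) 1 × ℝ) := ⟨(unitSpherePoint n, 0)⟩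
  exact IsOpenEmbedding.toOpenPartialHomeomorph_right_inv ψ D.isOpenEmbedding hp

/-- **The polar identification** of the upper half-neck with the punctured disc,
`ψ (θ, t) ↦ t • θ` (`t > 0`), as an open partial homeomorphism `P ⇀ E` with source
`ψ (Sⁿ × (0, ∞))` and target `E ∖ {0}`. [folklore] -/
def glueP (D : NeckCapData n ψ) : OpenPartialHomeomorph P E := D.Ψ.symm ≫ₕ polar (unitSpherePoint n)

/-- `glueP` acts as `polarVec ∘ ψ⁻¹`. [folklore] -/
theorem glueP_apply (D : NeckCapData n ψ) (p : P) : D.glueP p = polarVec (D.Ψ.symm p) := rfl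

/-- `glueP (ψ (θ, t)) = t • θ`. [folklore] -/
theorem glueP_apply_ψ (D : NeckCapData n ψ) (q : sphere (0 : E) 1 × ℝ) : D.glueP (ψ q) = q.2 • (q.1 : E) := by
  rw [glueP_apply, Ψ_symm_apply]
  rfl

/-- `glueP.symm x = ψ (x / ‖x‖, ‖x‖)`. [folklore] -/
theorem glueP_symm_apply (D : NeckCapData n ψ) (x : E) : D.glueP.symm x = ψ (polarInv (unitSpherePoint n) x) := rfl

/-- The source of `glueP` is the upper half-neck. [folklore] -/
theorem mem_glueP_source (D : NeckCapData n ψ) {p : P} :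
    p ∈ D.glueP.source ↔ ∃ (θ : sphere (0 : E) 1) (t : ℝ), 0 < t ∧ ψ (θ, t) = p := by
  simp only [glueP, trans_source, symm_source, Ψ_target, mem_inter_iff, mem_preimage,
    polar_source, mem_prod, mem_univ, true_and, mem_Ioi]
  constructor
  · rintro ⟨⟨⟨θ, t⟩, rfl⟩, h⟩
    rw [Ψ_symm_apply] at h
    exact ⟨θ, t, h, rfl⟩
  · rintro ⟨θ, t, ht, rfl⟩
    rw [Ψ_symm_apply]
    exact ⟨mem_range_self _, ht⟩

/-- The target of `glueP` is the punctured disc `E ∖ {0}`. [folklore] -/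
theorem mem_glueP_target (D : NeckCapData n ψ) {x : E} : x ∈ D.glueP.target ↔ x ≠ 0 := by
  simp only [glueP, trans_target, polar_target, mem_inter_iff, mem_compl_iff,
    mem_singleton_iff, mem_preimage, polar_symm_apply, symm_target, Ψ_source, mem_univ, and_true]

/-- The source of `glueP` lies in the side. [folklore] -/
theorem glueP_source_subset (D : NeckCapData n ψ) : D.glueP.source ⊆ D.side := by
  intro p hp
  obtain ⟨θ, t, ht, rfl⟩ := D.mem_glueP_source.1 hp
  exact D.mem_side θ ht

/-- **The gluing map of the cap**: `glueP` on the open submanifold `A`. [folklore] -/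
def glue (D : NeckCapData n ψ) : OpenPartialHomeomorph D.side E := D.glueP.subtypeRestr D.nonempty_side

/-- The source of `glue` is that of `glueP`. [folklore] -/
theorem mem_glue_source (D : NeckCapData n ψ) {a : D.side} : a ∈ D.glue.source ↔ (a : P) ∈ D.glueP.source := by
  rw [glue, subtypeRestr_source, mem_preimage]

/-- `glue` is `glueP` on the side. [folklore] -/
theorem glue_apply (D : NeckCapData n ψ) (a : D.side) : D.glue a = D.glueP a := rfl

/-- The target of `glue` is the punctured disc. [folklore] -/
theorem mem_glue_target (D : NeckCapData n ψ) {x : E} : x ∈ D.glue.target ↔ x ≠ 0 := by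
  constructor
  · intro hx
    exact D.mem_glueP_target.1 (D.glueP.subtypeRestr_target_subset D.nonempty_side hx)
  · intro hx
    have hsrc : (⟨ψ (polarInv (unitSpherePoint n) x), D.mem_side _ (norm_pos_iff.2 hx)⟩ : D.side) ∈
        D.glue.source := by
      rw [mem_glue_source, mem_glueP_source]
      exact ⟨_, _, norm_pos_iff.2 hx, rfl⟩
    have := D.glue.map_source hsrc
    rwa [glue_apply, Subtype.coe_mk, glueP_apply, Ψ_symm_apply,
      show polarVec (polarInv (unitSpherePoint n) x) = x from polarVec_polarInv _ hx] at this

/-- `glue.symm` is `glueP.symm` on the punctured disc. [folklore] -/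
theorem coe_glue_symm (D : NeckCapData n ψ) {x : E} (hx : x ≠ 0) :
    ((D.glue.symm x : D.side) : P) = ψ (polarInv (unitSpherePoint n) x) := by
  have h := D.glueP.subtypeRestr_symm_apply D.nonempty_side (D.mem_glue_target.2 hx)
  exact h

/-- The gluing map is smooth: `polarVec ∘ ψ⁻¹ ∘ (A ⊆ P)`, with `ψ⁻¹` smooth on the open
range of the smooth embedding `ψ` (`Literature.Topology.FourManifolds.contMDiffOn_leftInverse_of_isImmersion`). [folklore] -/
theorem contMDiffOn_glue (D : NeckCapData n ψ) : ContMDiffOn 𝓘(ℝ, E) 𝓘(ℝ, E) ∞ D.glue D.glue.source := by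
  have hΨs : ContMDiffOn 𝓘(ℝ, E) ((𝓡 n).prod 𝓘(ℝ, ℝ)) ∞ D.Ψ.symm (range ψ) :=
    contMDiffOn_leftInverse_of_isImmersion D.isSmoothEmbedding.isImmersion
      D.isSmoothEmbedding.isEmbedding fun q => D.Ψ_symm_apply q
  have hP : ContMDiffOn 𝓘(ℝ, E) 𝓘(ℝ, E) ∞ D.glueP D.glueP.source :=
    (contMDiff_polarVec.comp_contMDiffOn hΨs).mono fun p hp => by
      obtain ⟨θ, t, -, rfl⟩ := D.mem_glueP_source.1 hp
      exact mem_range_self _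
  exact hP.comp contMDiff_subtype_val.contMDiffOn fun a ha => D.mem_glue_source.1 ha

/-- The inverse gluing map is smooth: `ψ ∘ polarInv`, corestricted to the open submanifold
`A`. [folklore] -/
theorem contMDiffOn_glue_symm (D : NeckCapData n ψ) : ContMDiffOn 𝓘(ℝ, E) 𝓘(ℝ, E) ∞ D.glue.symm D.glue.target := by
  intro x hx
  have hx0 : x ≠ 0 := D.mem_glue_target.1 hx
  rw [← ContMDiffWithinAt.subtypeVal_comp_iff]
  have h : ContMDiffOn 𝓘(ℝ, E) 𝓘(ℝ, E) ∞ (ψ ∘ polarInv (unitSpherePoint n)) {0}ᶜ :=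
    D.isSmoothEmbedding.contMDiff.comp_contMDiffOn (contMDiffOn_polarInv _)
  refine ((h x hx0).mono fun y hy => D.mem_glue_target.1 hy).congr (fun y hy => ?_) ?_
  · exact D.coe_glue_symm (D.mem_glue_target.1 hy)
  · exact D.coe_glue_symm hx0

/-- **The gluing datum of the cap**: the side `A` and the disc `E`, glued along the polar
identification of the upper half-neck with the punctured disc. [folklore] -/
def glueData (D : NeckCapData n ψ) : SmoothGlueData 𝓘(ℝ, E) 𝓘(ℝ, E) D.side E E :=
  ⟨D.glue, D.contMDiffOn_glue, D.contMDiffOn_glue_symm, ContinuousLinearEquiv.refl ℝ E,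
    ContinuousLinearEquiv.refl ℝ E⟩

/-- **The capped side** `A ∪_{ψ (θ, t) ∼ t • θ} E`: the side with its end closed off by a disc
(Hamilton 1997, p. 3: "cutting the neck and rounding off the ends"; Chen–Zhu 2006, p. 25:
"`Ωⱼ` with each `ε`-horn one point compactified … glue back a cap"). A smooth manifold modelled
on `E` (`Literature.Topology.FourManifolds.SmoothGlueData.instIsManifold`). [cite: Hamilton1997, §1.1 p. 3] -/
abbrev Capped (D : NeckCapData n ψ) : Type (max u v) := D.glueData.Glued

/-- The disc point `t • θ` (`t > 0`) of the capped side is the neck point `ψ (θ, t)` of the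
side. [folklore] -/
theorem inl_eq_inr (D : NeckCapData n ψ) (θ : sphere (0 : E) 1) {t : ℝ} (ht : 0 < t) :
    D.glueData.inl ⟨ψ (θ, t), D.mem_side θ ht⟩ = D.glueData.inr (t • (θ : E)) := by
  rw [SmoothGlueData.inl_eq_inr_iff]
  refine ⟨?_, ?_⟩
  · change (⟨ψ (θ, t), D.mem_side θ ht⟩ : D.side) ∈ D.glue.source
    rw [mem_glue_source, mem_glueP_source]
    exact ⟨θ, t, ht, rfl⟩
  · change D.glue ⟨ψ (θ, t), D.mem_side θ ht⟩ = t • (θ : E)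
    rw [glue_apply, Subtype.coe_mk, glueP_apply_ψ]

/-- The side fills the capped side up to the centre of the disc. [folklore] -/
theorem range_inl (D : NeckCapData n ψ) : range D.glueData.inl = {D.glueData.inr 0}ᶜ := by
  apply Subset.antisymm
  · rintro _ ⟨a, rfl⟩ h
    rw [mem_singleton_iff, SmoothGlueData.inl_eq_inr_iff] at h
    obtain ⟨h1, h2⟩ := h
    have : (0 : E) ∈ D.glue.target := by
      rw [← show D.glue a = 0 from h2]
      exact D.glue.map_source h1
    exact (D.mem_glue_target.1 this) rfl
  · intro p hp
    rcases D.glueData.exists_inl_or_inr p with ⟨a, rfl⟩ | ⟨x, rfl⟩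
    · exact mem_range_self a
    · have hx : x ≠ 0 := fun h => hp (by rw [h]; rfl)
      exact ⟨_, D.glueData.inl_glue_symm (show x ∈ D.glue.target from D.mem_glue_target.2 hx)⟩

/-- The inclusion of the side into the capped side is an open smooth embedding. [folklore] -/
theorem isOpen_range_inl (D : NeckCapData n ψ) : IsOpen (range D.glueData.inl) := D.glueData.isOpen_range_inl

/-- **A smooth embedding into the side is a smooth embedding into the capped side** (after
`inl`): corestrict to the open submanifold `A` (`Manifold.IsSmoothEmbedding.codRestrict_opens`)
and compose with the open smooth embedding `inl` (`SmoothGlueData.isSmoothEmbedding_inl_comp`). In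
particular a neck of `P` lying in the side is a neck of the capped side, which is how surgeries
along disjoint necks are performed one at a time. [folklore] -/
theorem isSmoothEmbedding_inl_comp (D : NeckCapData n ψ) [IsManifold 𝓘(ℝ, E) ∞ P]
    {EQ HQ : Type*} [NormedAddCommGroup EQ] [NormedSpace ℝ EQ] [TopologicalSpace HQ]
    {IQ : ModelWithCorners ℝ EQ HQ} {Q : Type*} [TopologicalSpace Q] [ChartedSpace HQ Q]
    [IsManifold IQ ∞ Q] {g : Q → P} (hg : Manifold.IsSmoothEmbedding IQ 𝓘(ℝ, E) ∞ g)
    (hgs : ∀ q, g q ∈ D.side) :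
    Manifold.IsSmoothEmbedding IQ 𝓘(ℝ, E) ∞ (fun q => D.glueData.inl ⟨g q, hgs q⟩) :=
  D.glueData.isSmoothEmbedding_inl_comp (hg.codRestrict_opens D.side hgs)

/-- If moreover `g` has open range, so has `inl ∘ g`. [folklore] -/
theorem isOpen_range_inl_comp (D : NeckCapData n ψ) {Q : Type*} {g : Q → P}
    (hgo : IsOpen (range g)) (hgs : ∀ q, g q ∈ D.side) :
    IsOpen (range fun q => D.glueData.inl ⟨g q, hgs q⟩) := by
  have : range (fun q => D.glueData.inl ⟨g q, hgs q⟩) =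
      D.glueData.inl '' {a : D.side | (a : P) ∈ range g} := by
    apply Subset.antisymm
    · rintro _ ⟨q, rfl⟩
      exact ⟨⟨g q, hgs q⟩, mem_range_self q, rfl⟩
    · rintro _ ⟨a, ⟨q, hq⟩, rfl⟩
      refine ⟨q, ?_⟩
      change D.glueData.inl ⟨g q, hgs q⟩ = D.glueData.inl a
      congr 1
      exact Subtype.ext hq
  rw [this]
  exact D.glueData.isOpenMap_inl _ (hgo.preimage continuous_subtype_val)

/-! #### The capped side is Hausdorff -/

/-- Characterisation of the graph of the gluing map: `(a, x)` lies on it iff `x ≠ 0` and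
`a = ψ (x / ‖x‖, ‖x‖)`. [folklore] -/
theorem mem_graph_glue_iff (D : NeckCapData n ψ) (a : D.side) (x : E) :
    (a ∈ D.glue.source ∧ D.glue a = x) ↔ x ≠ 0 ∧ (a : P) = ψ (polarInv (unitSpherePoint n) x) := by
  constructor
  · rintro ⟨ha, rfl⟩
    obtain ⟨θ, t, ht, hθ⟩ := D.mem_glueP_source.1 (D.mem_glue_source.1 ha)
    rw [glue_apply, ← hθ, glueP_apply_ψ]
    exact ⟨polarVec_ne_zero (q := (θ, t)) ht, by
      change ψ (θ, t) = ψ (polarInv (unitSpherePoint n) (polarVec (θ, t)))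
      rw [polarInv_polarVec _ (show 0 < ((θ, t) : sphere (0 : E) 1 × ℝ).2 from ht)]⟩
  · rintro ⟨hx, ha⟩
    have hsrc : a ∈ D.glue.source := by
      rw [mem_glue_source, mem_glueP_source]
      exact ⟨_, _, norm_pos_iff.2 hx, ha.symm⟩
    refine ⟨hsrc, ?_⟩
    rw [glue_apply, ha, glueP_apply_ψ]
    exact polarVec_polarInv _ hx

/-- **The graph of the gluing map is closed** in `A × E`. Away from the centre this is the
continuity of `x ↦ ψ (x / ‖x‖, ‖x‖)` and Hausdorffness of `P`; at a point `(a, 0)` one uses that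
`a ∈ A` is off the compact middle sphere `ψ (Sⁿ × {0})`, so (tube lemma, `P` being locally
compact Hausdorff hence regular) a closed neighbourhood `K` of `a` misses a collar
`ψ (Sⁿ × (-ε, ε))`, whereas graph points `(a', x')` with `‖x'‖ < ε` have `a'` in that collar.
[folklore] -/
theorem isClosed_graph_glue (D : NeckCapData n ψ) [T2Space P] :
    IsClosed {p : D.side × E | p.1 ∈ D.glue.source ∧ D.glue p.1 = p.2} := by
  haveI : FiniteDimensional ℝ E := .of_fact_finrank_eq_succ (K := ℝ) (V := E) n
  haveI : LocallyCompactSpace P := ChartedSpace.locallyCompactSpace E P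
  set θ₀ : sphere (0 : E) 1 := unitSpherePoint n
  have hG : {p : D.side × E | p.1 ∈ D.glue.source ∧ D.glue p.1 = p.2} =
      {p : D.side × E | p.2 ≠ 0 ∧ ((p.1 : D.side) : P) = ψ (polarInv θ₀ p.2)} := by
    ext p
    exact D.mem_graph_glue_iff p.1 p.2
  rw [hG]
  refine isClosed_of_closure_subset fun p hp => ?_
  obtain ⟨a, x⟩ := p
  rw [mem_closure_iff_nhds] at hp
  by_cases hx : x = 0
  · -- the centre: a closed neighbourhood of `a` off a collar of the middle sphere
    subst hx
    exfalso
    set Z : Set P := ψ '' (univ ×ˢ {(0 : ℝ)}) with hZ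
    have hZc : IsClosed Z :=
      ((isCompact_univ.prod isCompact_singleton).image D.isSmoothEmbedding.contMDiff.continuous).isClosed
    have haZ : (a : P) ∉ Z := by
      rintro ⟨⟨θ, t⟩, ⟨-, ht⟩, h⟩
      rw [mem_singleton_iff] at ht
      subst ht
      exact D.not_mem_side θ 0 le_rfl (h ▸ a.2)
    obtain ⟨K, hKa, hKc, hKZ⟩ := exists_mem_nhds_isClosed_subset (hZc.isOpen_compl.mem_nhds haZ)
    -- tube lemma: a collar `ψ (Sⁿ × v)` of the middle sphere misses `K`
    have hO : IsOpen (ψ ⁻¹' Kᶜ) := hKc.isOpen_compl.preimage D.isSmoothEmbedding.contMDiff.continuous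
    have hsub : (univ : Set (sphere (0 : E) 1)) ×ˢ ({0} : Set ℝ) ⊆ ψ ⁻¹' Kᶜ := by
      rintro ⟨θ, t⟩ ⟨-, ht⟩ hK
      rw [mem_singleton_iff] at ht
      subst ht
      exact hKZ hK ⟨(θ, 0), ⟨mem_univ _, rfl⟩, rfl⟩
    obtain ⟨u', v, -, hv, hu', h0v, huv⟩ :=
      generalized_tube_lemma isCompact_univ isCompact_singleton hO hsub
    have h0v' : (0 : ℝ) ∈ v := h0v rfl
    obtain ⟨ε, hε, hεv⟩ := Metric.isOpen_iff.1 hv 0 h0v'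
    -- the neighbourhood `{a' | a' ∈ K} × ball 0 ε` of `(a, 0)` misses the graph
    have hN : (Subtype.val ⁻¹' K : Set D.side) ×ˢ ball (0 : E) ε ∈ 𝓝 (a, (0 : E)) :=
      prod_mem_nhds (continuous_subtype_val.continuousAt.preimage_mem_nhds hKa)
        (ball_mem_nhds _ hε)
    obtain ⟨⟨a', x'⟩, ⟨ha'K, hx'⟩, hx'0, ha'⟩ := hp _ hN
    simp only [mem_preimage] at ha'K
    rw [mem_ball_zero_iff] at hx'
    have hmem : polarInv θ₀ x' ∈ (univ : Set (sphere (0 : E) 1)) ×ˢ v := by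
      refine ⟨mem_univ _, hεv ?_⟩
      rw [mem_ball_zero_iff]
      change ‖(‖x'‖ : ℝ)‖ < ε
      rwa [norm_norm]
    have := huv (mk_mem_prod (hu' (mem_univ (polarInv θ₀ x').1)) hmem.2)
    rw [mem_preimage, Prod.mk.eta] at this
    exact this (ha' ▸ ha'K)
  · -- off the centre: continuity and Hausdorffness
    by_contra hnot
    have hne : (a : P) ≠ ψ (polarInv θ₀ x) := fun h => hnot ⟨hx, h⟩
    obtain ⟨U, V, hU, hV, haU, hbV, hUV⟩ := t2_separation hne
    have hcont : ContinuousAt (fun x' => ψ (polarInv θ₀ x')) x :=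
      (D.isSmoothEmbedding.contMDiff.continuous.continuousAt).comp
        ((continuousOn_polarInv θ₀).continuousAt (isOpen_compl_singleton.mem_nhds hx))
    have hW : (fun x' => ψ (polarInv θ₀ x')) ⁻¹' V ∈ 𝓝 x := hcont.preimage_mem_nhds (hV.mem_nhds hbV)
    have hN : (Subtype.val ⁻¹' U : Set D.side) ×ˢ ((fun x' => ψ (polarInv θ₀ x')) ⁻¹' V) ∈
        𝓝 (a, x) :=
      prod_mem_nhds (continuous_subtype_val.continuousAt.preimage_mem_nhds (hU.mem_nhds haU)) hW
    obtain ⟨⟨a', x'⟩, ⟨ha'U, hx'V⟩, -, ha'⟩ := hp _ hN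
    simp only [mem_preimage] at ha'U hx'V
    exact Set.disjoint_left.1 hUV ha'U (ha' ▸ hx'V)

/-- The capped side is Hausdorff. [folklore] -/
instance instT2SpaceCapped (D : NeckCapData n ψ) [T2Space P] : T2Space D.Capped :=
  D.glueData.t2Space_of_isClosed_graph D.isClosed_graph_glue

/-! #### The capped side is compact -/

/-- The compact piece `A ∖ ψ (Sⁿ × (0, 1))` of the side (it is closed in `P`: its complement is
the far side together with the open collar `ψ (Sⁿ × (-∞, 1))`). [folklore] -/
def sidePiece (D : NeckCapData n ψ) : Set D.side := {a | (a : P) ∉ ψ '' (univ ×ˢ Ioo 0 1)}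

/-- `A ∖ ψ (Sⁿ × (0, 1))` is compact when `P` is. [folklore] -/
theorem isCompact_sidePiece (D : NeckCapData n ψ) [CompactSpace P] : IsCompact D.sidePiece := by
  have himg : Subtype.val '' D.sidePiece = (D.side : Set P) ∩ (ψ '' (univ ×ˢ Ioo 0 1))ᶜ := by
    ext p
    constructor
    · rintro ⟨a, ha, rfl⟩
      exact ⟨a.2, ha⟩
    · rintro ⟨hp, hp'⟩
      exact ⟨⟨p, hp⟩, hp', rfl⟩
  have hcl : IsClosed ((D.side : Set P) ∩ (ψ '' (univ ×ˢ Ioo 0 1))ᶜ) := by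
    have heq : ((D.side : Set P) ∩ (ψ '' (univ ×ˢ Ioo 0 1))ᶜ)ᶜ =
        ((D.side : Set P) ∪ ψ '' (univ ×ˢ {0}))ᶜ ∪ ψ '' (univ ×ˢ Iio 1) := by
      ext p
      simp only [mem_compl_iff, mem_inter_iff, not_and, not_not, mem_union]
      constructor
      · intro h
        by_cases hp : p ∈ (D.side : Set P)
        · obtain ⟨⟨θ, t⟩, ⟨-, ht⟩, rfl⟩ := h hp
          exact Or.inr ⟨(θ, t), ⟨mem_univ _, ht.2⟩, rfl⟩
        · by_cases hp0 : p ∈ ψ '' (univ ×ˢ {(0 : ℝ)})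
          · obtain ⟨⟨θ, t⟩, ⟨-, ht⟩, rfl⟩ := hp0
            rw [mem_singleton_iff] at ht
            exact Or.inr ⟨(θ, t), ⟨mem_univ _, by rw [ht]; exact (zero_lt_one : (0 : ℝ) < 1)⟩, rfl⟩
          · exact Or.inl fun h' => h'.elim hp hp0
      · rintro (h | ⟨⟨θ, t⟩, ⟨-, ht⟩, rfl⟩) hp
        · exact absurd (Or.inl hp) h
        · have ht0 : 0 < t := (D.mem_side_iff θ t).1 hp
          exact ⟨(θ, t), ⟨mem_univ _, ⟨ht0, ht⟩⟩, rfl⟩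
    rw [← isOpen_compl_iff, heq]
    exact D.isClosed_side_union.isOpen_compl.union
      (D.isOpenEmbedding.isOpenMap _ (isOpen_univ.prod isOpen_Iio))
  rw [Subtype.isCompact_iff, himg]
  exact hcl.isCompact

/-- The capped side is compact when `P` is: it is covered by the images of the compact piece
`A ∖ ψ (Sⁿ × (0, 1))` and of the closed unit disc. [folklore] -/
instance instCompactSpaceCapped (D : NeckCapData n ψ) [CompactSpace P] : CompactSpace D.Capped := by
  haveI : FiniteDimensional ℝ E := .of_fact_finrank_eq_succ (K := ℝ) (V := E) n
  refine D.glueData.compactSpace_of_forall_not_mem D.isCompact_sidePiece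
    (isCompact_closedBall (0 : E) 1) (fun a ha => ?_) fun x hx => ?_
  · simp only [sidePiece, mem_setOf_eq, not_not] at ha
    obtain ⟨⟨θ, t⟩, ⟨-, ht⟩, hθ⟩ := ha
    have hsrc : a ∈ D.glue.source := by
      rw [mem_glue_source, mem_glueP_source]
      exact ⟨θ, t, ht.1, hθ⟩
    refine ⟨hsrc, ?_⟩
    change D.glue a ∈ closedBall (0 : E) 1
    rw [glue_apply, ← hθ, glueP_apply_ψ, mem_closedBall_zero_iff, norm_smul,
      mem_sphere_zero_iff_norm.1 θ.2, mul_one, Real.norm_eq_abs, abs_of_pos ht.1]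
    exact ht.2.le
  · rw [mem_closedBall_zero_iff, not_le] at hx
    have hx0 : x ≠ 0 := by
      rintro rfl
      rw [norm_zero] at hx
      exact not_lt.2 zero_le_one hx
    refine ⟨D.mem_glue_target.2 hx0, ?_⟩
    change (D.glue.symm x : D.side) ∈ D.sidePiece
    simp only [sidePiece, mem_setOf_eq]
    rw [D.coe_glue_symm hx0]
    rintro ⟨⟨θ, t⟩, ⟨-, ht⟩, h⟩
    have h2 := (Prod.mk.inj (D.injective h)).2
    change t = ‖x‖ at h2
    rw [h2] at ht
    exact not_lt.2 ht.2.le hx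

/-- The capped side is second countable (compact case). [folklore] -/
instance instSecondCountableCapped (D : NeckCapData n ψ) [T2Space P] [CompactSpace P]
    [IsManifold 𝓘(ℝ, E) ∞ P] :
    SecondCountableTopology D.Capped := by
  haveI : FiniteDimensional ℝ E := .of_fact_finrank_eq_succ (K := ℝ) (V := E) n
  exact D.glueData.secondCountableTopology

/-! #### The connected-sum splitting -/

/-- **Surgery along a neck yields a connected-sum splitting.** Let `D₁` be a side of the neck
`ψ` and `D₂` a side of the flipped neck `ψ⁻ (θ, t) = ψ (θ, -t)` (i.e. the other side of `ψ`),
disjoint and covering `P` off the middle sphere. Then `P` is the connected sum of the two capped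
sides, `P ≅ D₁.Capped # D₂.Capped`, with discs the caps `inr : E → Dᵢ.Capped` — Hamilton's
"replacing two `B⁴`'s with an `S³ × B¹` … recovers the original manifold" (1997, p. 4) and
Chen–Zhu's "`M⁴` is diffeomorphic to a connected sum of the `Ω̄ⱼ`" (2006, arXiv p. 25), via the
neck-presentation criterion `Literature.Topology.FourManifolds.isConnectedSum_of_neck'` (Kosinski VI §1: joining by a tube).
[cite: Hamilton1997, §1.1 p. 4] [cite: Kosinski1993, Ch. VI §1 (p. 90; Prop. 1.3)] -/
theorem isConnectedSum_capped [T2Space P] [IsManifold 𝓘(ℝ, E) ∞ P]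
    {ψ' : sphere (0 : E) 1 × ℝ → P} (D₁ : NeckCapData n ψ) (D₂ : NeckCapData n ψ')
    (hflip : ∀ (θ : sphere (0 : E) 1) (t : ℝ), ψ' (θ, t) = ψ (θ, -t))
    (hdisj : Disjoint (D₁.side : Set P) D₂.side)
    (hcover : ∀ p : P, p ∉ D₁.side → p ∉ D₂.side → ∃ θ : sphere (0 : E) 1, ψ (θ, 0) = p) :
    IsConnectedSum 𝓘(ℝ, E) 𝓘(ℝ, E) 𝓘(ℝ, E) D₁.Capped D₂.Capped P := by
  have hr₁ : range (Subtype.val : D₁.side → P) = D₁.side := Subtype.range_coe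
  have hr₂ : range (Subtype.val : D₂.side → P) = D₂.side := Subtype.range_coe
  refine isConnectedSum_of_neck' (ψ := ψ) D₁.glueData.isSmoothEmbedding_inr
    D₂.glueData.isSmoothEmbedding_inr D₁.glueData.isSmoothEmbedding_inl D₁.range_inl
    D₂.glueData.isSmoothEmbedding_inl D₂.range_inl D₁.isSmoothEmbedding D₁.isOpen_range
    (Manifold.IsSmoothEmbedding.of_opens D₁.side) (by rw [hr₁]; exact D₁.side.2)
    (Manifold.IsSmoothEmbedding.of_opens D₂.side) (by rw [hr₂]; exact D₂.side.2)
    (by rw [hr₁, hr₂]; exact hdisj) (fun θ h => ?_) (fun θ h => ?_) (fun p h₁ h₂ => ?_)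
    (fun θ t ht => ?_) (fun θ t ht => ?_)
  · rw [hr₁] at h
    exact D₁.not_mem_side θ 0 le_rfl h
  · rw [hr₂] at h
    have : ψ' (θ, 0) = ψ (θ, 0) := by rw [hflip, neg_zero]
    exact D₂.not_mem_side θ 0 le_rfl (this ▸ h)
  · rw [hr₁] at h₁
    rw [hr₂] at h₂
    exact hcover p h₁ h₂
  · exact ⟨⟨ψ (θ, t), D₁.mem_side θ ht⟩, D₁.inl_eq_inr θ ht, rfl⟩
  · refine ⟨⟨ψ' (θ, t), D₂.mem_side θ ht⟩, D₂.inl_eq_inr θ ht, ?_⟩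
    exact hflip θ t

end NeckCapData

/-! ### The simply connected case -/

/-- The flipped neck `(θ, t) ↦ ψ (θ, -t)` is again a smooth embedding. [folklore] -/
theorem isSmoothEmbedding_neck_flip {ψ : sphere (0 : E) 1 × ℝ → P}
    (hψ : Manifold.IsSmoothEmbedding ((𝓡 n).prod 𝓘(ℝ, ℝ)) 𝓘(ℝ, E) ∞ ψ) :
    Manifold.IsSmoothEmbedding ((𝓡 n).prod 𝓘(ℝ, ℝ)) 𝓘(ℝ, E) ∞
      (fun q : sphere (0 : E) 1 × ℝ => ψ (q.1, -q.2)) := by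
  let ν : ℝ ≃ₘ⟮𝓘(ℝ, ℝ), 𝓘(ℝ, ℝ)⟯ ℝ := (ContinuousLinearEquiv.neg ℝ : ℝ ≃L[ℝ] ℝ).toDiffeomorph
  let Φ : (sphere (0 : E) 1 × ℝ) ≃ₘ⟮(𝓡 n).prod 𝓘(ℝ, ℝ), (𝓡 n).prod 𝓘(ℝ, ℝ)⟯
      (sphere (0 : E) 1 × ℝ) := (Diffeomorph.refl (𝓡 n) (sphere (0 : E) 1) ∞).prodCongr ν
  have h := hψ.comp_diffeomorph Φ
  exact h

omit [InnerProductSpace ℝ E] [Fact (finrank ℝ E = n + 1)] [TopologicalSpace P]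
  [ChartedSpace E P] in
/-- The flipped neck has the same range. [folklore] -/
theorem range_neck_flip (ψ : sphere (0 : E) 1 × ℝ → P) :
    range (fun q : sphere (0 : E) 1 × ℝ => ψ (q.1, -q.2)) = range ψ := by
  apply Subset.antisymm
  · rintro _ ⟨q, rfl⟩
    exact mem_range_self _
  · rintro _ ⟨⟨θ, t⟩, rfl⟩
    exact ⟨(θ, -t), by simp⟩

/-- **In a simply connected manifold every neck has two sides.** If `P` is Hausdorff, connected
and simply connected, `n ≠ 0` (so that `Sⁿ` is connected), and `ψ : Sⁿ × ℝ → P` is a neck, then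
the two halves of `P ∖ ψ (Sⁿ × {0})` (`Literature.Topology.FourManifolds.exists_two_sides_of_neck`; Hirsch, *Differential
Topology*, Ch. 4, Thm. 4.6 and Lemma 4.4) are sides of `ψ` and of the flipped neck, disjoint and
covering `P` off the middle sphere. [cite: Hirsch1976, Ch. 4 Thm. 4.6, Lemma 4.4 (p. 107)] -/
theorem exists_neckCapData_of_simplyConnected [T2Space P] [SimplyConnectedSpace P]
    [IsManifold 𝓘(ℝ, E) ∞ P] (hn : n ≠ 0)
    {ψ : sphere (0 : E) 1 × ℝ → P}
    (hψ : Manifold.IsSmoothEmbedding ((𝓡 n).prod 𝓘(ℝ, ℝ)) 𝓘(ℝ, E) ∞ ψ) (hψo : IsOpen (range ψ)) :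
    ∃ (D₁ : NeckCapData n ψ) (D₂ : NeckCapData n (fun q : sphere (0 : E) 1 × ℝ => ψ (q.1, -q.2))),
      Disjoint (D₁.side : Set P) D₂.side ∧
      ∀ p : P, p ∉ D₁.side → p ∉ D₂.side → ∃ θ : sphere (0 : E) 1, ψ (θ, 0) = p := by
  haveI : FiniteDimensional ℝ E := .of_fact_finrank_eq_succ (K := ℝ) (V := E) n
  haveI : LocallyPathConnectedSpace P := ChartedSpace.locallyPathConnectedSpace E P
  haveI : ConnectedSpace (sphere (0 : E) 1) := by
    have h1 : 1 < Module.rank ℝ E := by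
      rw [← Module.finrank_eq_rank, (Fact.out : finrank ℝ E = n + 1)]
      exact_mod_cast (by omega : 1 < n + 1)
    exact isConnected_iff_connectedSpace.1 (isConnected_sphere h1 (0 : E) zero_le_one)
  haveI : Nonempty (sphere (0 : E) 1) := ⟨unitSpherePoint n⟩
  have hψe : IsOpenEmbedding ψ := ⟨hψ.isEmbedding, hψo⟩
  obtain ⟨A, B, hA, hB, hAB, hABZ, hIoi, hIio⟩ := exists_two_sides_of_neck hψe
  set Z : Set P := ψ '' (univ ×ˢ {(0 : ℝ)}) with hZ
  have hZ' : (fun q : sphere (0 : E) 1 × ℝ => ψ (q.1, -q.2)) '' (univ ×ˢ {(0 : ℝ)}) = Z := by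
    apply Subset.antisymm
    · rintro _ ⟨⟨θ, t⟩, ⟨-, ht⟩, rfl⟩
      rw [mem_singleton_iff] at ht
      subst ht
      exact ⟨(θ, 0), ⟨mem_univ _, rfl⟩, by simp⟩
    · rintro _ ⟨⟨θ, t⟩, ⟨-, ht⟩, rfl⟩
      rw [mem_singleton_iff] at ht
      subst ht
      exact ⟨(θ, 0), ⟨mem_univ _, rfl⟩, by simp⟩
  have hAZ : ∀ p ∈ A, p ∉ Z := fun p hp hz => hABZ.subset (Or.inl hp) hz
  have hBZ : ∀ p ∈ B, p ∉ Z := fun p hp hz => hABZ.subset (Or.inr hp) hz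
  have hcA : (A ∪ Z)ᶜ = B := by
    ext p
    simp only [mem_compl_iff, mem_union, not_or]
    constructor
    · rintro ⟨hpA, hpZ⟩
      have : p ∈ A ∪ B := hABZ.symm.subset hpZ
      exact this.resolve_left hpA
    · intro hpB
      exact ⟨fun hpA => Set.disjoint_left.1 hAB hpA hpB, hBZ p hpB⟩
  have hcB : (B ∪ Z)ᶜ = A := by
    ext p
    simp only [mem_compl_iff, mem_union, not_or]
    constructor
    · rintro ⟨hpB, hpZ⟩
      have : p ∈ A ∪ B := hABZ.symm.subset hpZ
      exact this.resolve_right hpB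
    · intro hpA
      exact ⟨fun hpB => Set.disjoint_left.1 hAB hpA hpB, hAZ p hpA⟩
  refine ⟨⟨hψ, hψo, ⟨A, hA⟩, ?_, hIoi, ?_⟩,
    ⟨isSmoothEmbedding_neck_flip hψ, by rw [range_neck_flip]; exact hψo, ⟨B, hB⟩, ?_, ?_, ?_⟩,
    hAB, fun p h₁ h₂ => ?_⟩
  · rw [← isOpen_compl_iff, show ((⟨A, hA⟩ : TopologicalSpace.Opens P) : Set P) = A from rfl, hcA]
    exact hB
  · intro θ t ht h
    change ψ (θ, t) ∈ A at h
    rcases ht.eq_or_lt with rfl | ht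
    · exact hAZ _ h ⟨(θ, 0), ⟨mem_univ _, rfl⟩, rfl⟩
    · exact Set.disjoint_left.1 hAB h (hIio ⟨(θ, t), ⟨mem_univ _, ht⟩, rfl⟩)
  · rw [← isOpen_compl_iff, show ((⟨B, hB⟩ : TopologicalSpace.Opens P) : Set P) = B from rfl,
      hZ', hcB]
    exact hA
  · rintro _ ⟨⟨θ, t⟩, ⟨-, ht⟩, rfl⟩
    change ψ (θ, -t) ∈ B
    exact hIio ⟨(θ, -t), ⟨mem_univ _, by simpa using ht⟩, rfl⟩
  · intro θ t ht h
    change ψ (θ, -t) ∈ B at h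
    rcases ht.eq_or_lt with rfl | ht
    · rw [neg_zero] at h
      exact hBZ _ h ⟨(θ, 0), ⟨mem_univ _, rfl⟩, rfl⟩
    · exact Set.disjoint_left.1 hAB (hIoi ⟨(θ, -t), ⟨mem_univ _, by simpa using ht⟩, rfl⟩) h
  · have hp : p ∉ A ∪ B := fun h => h.elim h₁ h₂
    rw [hABZ] at hp
    obtain ⟨⟨θ, t⟩, ⟨-, ht⟩, rfl⟩ := not_notMem.1 hp
    rw [mem_singleton_iff] at ht
    subst ht
    exact ⟨θ, rfl⟩

/-- **Surgery along a neck of a simply connected closed manifold splits it as a connected sum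
of two simply connected closed manifolds** (Hamilton 1997, §1.1 pp. 3–4, the reconstruction
"replacing two `B⁴`'s with an `S³ × B¹`" in the simply connected case of Cor. 1.2(a); Chen–Zhu
2006, arXiv p. 25). For `P` compact, connected, simply connected, Hausdorff, modelled on the
inner product space `E` of dimension `n + 1 ≥ 2`, and any neck `ψ : Sⁿ × ℝ ↪ P`, the capped
sides `M₁`, `M₂` of `ψ` are compact simply connected smooth manifolds with `P ≅ M₁ # M₂`
(`IsConnectedSum`); simple connectivity of the summands is Kosinski VI Prop. 2.1
(`Literature.IsConnectedSum.simplyConnectedSpace_left/right`). [cite: Hamilton1997, §1.1 pp. 3–4] -/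
theorem exists_isConnectedSum_capped_of_simplyConnected [T2Space P] [CompactSpace P]
    [SimplyConnectedSpace P] [IsManifold 𝓘(ℝ, E) ∞ P] (hn : n ≠ 0)
    {ψ : sphere (0 : E) 1 × ℝ → P}
    (hψ : Manifold.IsSmoothEmbedding ((𝓡 n).prod 𝓘(ℝ, ℝ)) 𝓘(ℝ, E) ∞ ψ) (hψo : IsOpen (range ψ)) :
    ∃ (D₁ : NeckCapData n ψ) (D₂ : NeckCapData n (fun q : sphere (0 : E) 1 × ℝ => ψ (q.1, -q.2))),
      IsConnectedSum 𝓘(ℝ, E) 𝓘(ℝ, E) 𝓘(ℝ, E) D₁.Capped D₂.Capped P ∧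
      SimplyConnectedSpace D₁.Capped ∧ SimplyConnectedSpace D₂.Capped := by
  obtain ⟨D₁, D₂, hdisj, hcover⟩ := exists_neckCapData_of_simplyConnected hn hψ hψo
  have h : IsConnectedSum 𝓘(ℝ, E) 𝓘(ℝ, E) 𝓘(ℝ, E) D₁.Capped D₂.Capped P :=
    D₁.isConnectedSum_capped D₂ (fun _ _ => rfl) hdisj hcover
  have h2 : 1 < finrank ℝ E := by
    rw [(Fact.out : finrank ℝ E = n + 1)]
    omega
  exact ⟨D₁, D₂, h, h.simplyConnectedSpace_left h2, h.simplyConnectedSpace_right h2⟩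

end Cap

end Literature.Topology.FourManifolds
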